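import Literature.MathematicalPhysics.QuantumFieldTheory.Balaban1983to89.Node00.Record11CarriersB12
import Literature.MathematicalPhysics.QuantumFieldTheory.Balaban1983to89.B13NodeKnitRecord5C
import Literature.MathematicalPhysics.QuantumFieldTheory.Balaban1983to89.B13NodeTorusTermwise

/-!
# NODE 00 (YM-PLAN Track A) — STAGE 3′(X.B13): THE [B13] CARRIER GROUP OF RECORD = THE TWO-SCALE TORUS STEP OF RECORD WITH ITS TERM TOWER
# (`ResidB13`, `WtOfRecord`, `c13OfRecord`, `withB13OfRecord` ∕ `XB13OfRecord`, the Stage-11 pin `pinB13`, the SEVEN-pin view and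
# `IsRecordOfRecord₁₁CB10YZWB8B12B13 → IsRecordOfRecord₁₁CB10YZWB8B12`, SAME datum, SAME world), and what N10 reads at such a record, by name

NODE 00 DEFINER MODULE (seat `pub-ymgap-node00-def-B13`, 2026-08-26; director-ym R141 (A) row «`Node00/CarriersB13.lean`, term tower; N10 s1 pin half»;
design = `pub-ymgap-node00-def/STAGE10-CARRIERS-DESIGN-g29.md` §2 row X.B13 + dag-p2's `N10-PIN-LIST.md` v3 ∕ `N10-OBJECTS.md`; stacked on the sibling [B12] pin of seat
node00-def g32, `Node00/CarriersB12` + `Node00/Record11CarriersB12`).  APPEND-ONLY: a NEW importing module; `Record11CarriersB12` (hence the whole NODE 00 record chain),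
`B13NodeKnitRecord5C`, `B13NodeTorusTermwise` untouched and CONSUMED BY NAME.
[Balaban1988RG2Cluster] = T. Bałaban, *Renormalization group approach to lattice gauge field theories. II. Cluster expansions*, Commun. Math. Phys.
**116** (1988) 1–22; [Balaban1987RG1] = part I, Commun. Math. Phys. **109** (1987) 249–301.

THE PIN.  The DAG's [B13] group of a run's carrier bundle `X : PrintedCarriersR` is `(X.S13 : B13.StepData, X.c13 : B13.Consts)`, read by the leaf
`b13 := B13.Lemma1Printed X.S13 X.c13 ∧ B13.Lemma2Printed X.S13 X.c13 ∧ B13.Lemma3Printed X.S13 X.c13` (today's binding carries ONE step per run).  At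
Stage-3 parameters `θ` and a RESIDUAL TERM LAYER `lam : ResidB13 θ` (data, NO law) the group OF RECORD is
* `S13 := (WtOfRecord θ lam).toStepData` for **the two-scale torus step of record** `WtOfRecord θ lam : B13Lemma3Torus.TwoTorusStep 4 (θ.ℓ₆ + 1) (lam.n + 1)`:
  d = 4; block size `θ.ℓ₆ + 1 = θ.L` (`Stage3Params.hℓ₆`, the `NeZero` device of `D6OfRecord`); 𝐃_k = the localization domains of the fine torus with
  `(θ.ℓ₆+1)·(lam.n+1)` M-cubes per direction, 𝐃_{k+1} = those of the coarse torus with `lam.n + 1` LM-cubes per direction (`TreeLengthTorus.tsys`, d_k ∕ d_{k+1} =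
  `torusTreeLen`); and, PINNED BY CONSTRUCTION, `volk Y := Y.1.card` (print's M⁻⁴|Y|, (1.43) p. 11), `Analytic f s := AnalyticOnNhd ℂ f s` on the (residual)
  complex normed configuration space ([I] §3: analyticity in (𝐔, 𝐉, B)), and THE TERM TOWER — print's DEFINITIONS of the step's functions as the displayed
  sums of their terms: `Vp Y` := the (1.33) double sum (p. 9: V′_k(Y) = the terms of (1.25)–(1.32) localized in Y, in the shape of
  `B13NodeTorusTermwise.b13Leaf_twoTorus_termwise`'s hypothesis `h133`), `Vpp Y φ := Vp Y φ + Gl Y φ` ((1.41)–(1.42) p. 11: V″_k = V′_k + the curvature terms;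
  `hVpp`), `V Y φ := Σ_{i ∈ s Y} scaled g (Wf Y i φ) (rd Y φ) + Vpp Y φ` ((1.41) p. 11 with [I] (2.12)'s scaling; `hV`), `Q Y φ b b′ := 2·Σ_{i ∈ s Y} Qop (scaled g (Wf Y i
  φ)) (rd Y φ) (e Y b) (e Y b′)` ((1.40)–(1.42); `hQ`), `rd Y φ := Σ_b Bv φ b • e Y b` (`hrd`), `H Z φ := Σ_{t ∈ terms (θ.ℓ₆+1) (lam.m₃+1) Z} T₃ Z t φ` ((2.9)–(2.14)
  pp. 14–15: H(Z) = the sum of its terms (𝐃, P); so `B13Lemma3TorusSocket.TermDomination` HOLDS, `termDomination_WtOfRecord`);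
* `c13 := c13OfRecord θ lam := { lam.c with L := θ.ℓ₆ + 1 }` (the run's block size; every other letter residual).
RESIDUAL (fields of `ResidB13 θ`, displayed, quantified with the record's parameters downstream, NO law assumed): the torus and step indices `n k`, the
configuration space `Φ` with its complex normed structure, the bond index type `Bond` and bond variables `Bv`, the spaces `sp1` ((1.34) p. 9) and `sp2` (p. 15),
the (1.33) index families and terms `S0 F Sq SX T Sc Sq' SX' T'`, the curvature terms `Gl`, the one-plaquette data `E ι₂ s Wf g e` of (1.40)–(1.42), the bond
fineness `m₃` and the terms `T₃` of H, the effective-action pieces `Ek1 Elog` (p. 21), the predicates `GaugeInv` ((I.3.29)), `Repr17` ((I.1.7)) and the restriction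
sentence `Restr` of Lemma 3 (NOT pinned: its located form reads the running coupling, cell census R1–R24), and the constants `c` but `L`.  def-T's `TermTowerOfRecord`
(the identification of these terms with the record's expansion (1.25)–(1.32)) is NOT in the tree; a successor sub-pin re-points `lam` at it.  LOCATED (SAID): the
step's tori are `TreeLengthTorus`'s abstract nested tori of sizes `((θ.ℓ₆+1)·(lam.n+1), lam.n+1)`, not re-derived from the run's `F.P p.K`; one layer per run.

WHAT IS PROVED (kernel bookkeeping, 0 sorry).  §1 the group of record and its faces: `WtOfRecord_volk ∕ _Vp ∕ _Vpp ∕ _V ∕ _Q ∕ _H ∕ _rd` (`rfl` — the closers'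
identification hypotheses `hvolk h133 hVpp hV hQ hrd` DISCHARGED at the group of record), `ResidB13.analytic_add ∕ analytic_zero` (their `hAdd ∕ hZero`),
`termDomination_WtOfRecord` (their `hH`), `c13OfRecord_L` (their `hLc`, `rfl`) ∕ `c13OfRecord_L_eq_L : … = θ.L`; `B13LeafOfRecord θ lam` := the leaf triple at the
group of record; `withB13OfRecord` and its `rfl`s (`_S13 ∕ _c13 ∕ _runs10 ∕ _F12 ∕ _c12`, `b13Leaf_withB13OfRecord_iff`, `withRuns10_withB13OfRecord`,
`withB8OfRecord_withB13OfRecord`, `carriers₃_withB13OfRecord`); HONESTY: `nonempty_residB13`, **`exists_residB13_not_b13LeafOfRecord`** (the ∀-form of N10 over this pin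
is junk-REFUTABLE through the residual layer — R433 species) and **`exists_residB13_b13LeafOfRecord`** (with EMPTY spaces the leaf holds VACUOUSLY — the ∃-form is
junk-INHABITABLE; «INHABITED-AT» audits must check `sp1 ∕ sp2` non-empty and `Restr` satisfiable).  §2 the run-indexed pinned bundle `XB13OfRecord θ₃ lam X P :=
(X P).withB13OfRecord θ₃ (lam P)` (= the N10 consumers' literal `rebindS13` update `{ X P with S13 := …, c13 := … }`, `XB13OfRecord_apply : rfl`; `_runs10 ∕ _F12`,
`withB12_withB13OfRecord : rfl`) and N10 BY NAME at a Stage-5 `X`-re-binding by it (`Record11Carriers.Stage5Params.rebindX`): `b13_main_iff_rebindX_XB13OfRecord`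
(`B13NodeKnitRecord5C.b13_main_iff_res₅C`), `b13_leaf_iff_rebindX_XB13OfRecord`, the S-binding reading `…S`, and `b13_main_at_rebindX_XB13OfRecord`
(`b13_main_at_stage5ParamsC_twoTorus` with `hS hc := rfl`).  §3 the Stage-11 pin `Stage11Params.pinB13 θ lam := θ.rebindX (XB13OfRecord θ.toStage3Params lam θ.res.X)`
(g31's generic re-binding — KERNEL LESSON 7 of the lineage: a pinned-vs-unpinned `rfl` whose difference sits in `res.X` exhausts the default heartbeats; this seat met
it again at Stage 5 — six single-leaf `rfl`s over a `{ θ with res := … }` pin timed out at `whnf` — hence NO Stage-5 ∕ 9 structure pin here, only the generic re-binding):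
`pinB13_X` (`rfl`), `_admissible_iff` (`Iff.rfl`), `_toStage3Params ∕ _toStage9Params` (`rfl`), `F12OfRecord₁₁_pinB13 ∕ b12LeafOfRecord₁₁_pinB13_iff ∕ WOfRecord₁₁_pinB13`
(`rfl`: the sibling's frame of record and the [IV] bundle read no carrier of `X`), `Provisos₁₁.pinB13` (`rebindX`), `toStage5₁₁_pinB13` (`toStage5₁₁_rebindX`),
**`datumOfRecord₁₁_pinB13`** (UP-SIDE, `datumOfRecord₁₁_rebindX`).  §4 the SEVEN-PIN view `view₁₁B13B12B8B10YZW θ lam13 lam12 lam8 … := (θ.pinB13 lam13).view₁₁B12B8B10YZW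
lam12 lam8 …` ([B13] innermost, so every earlier face is the earlier modules' face at `θ.pinB13 lam13` BY NAME), its leaves (`b13 : Iff.rfl` + the sibling's six),
**`IsRecordOfRecord₁₁CB10YZWB8B12B13 D w`** := `IsRecordOfRecord₁₁CB10YZWB8B12` VERBATIM with the [B13] layer added, `exists_world_…` ∕ `exists_…` (inhabitation = ₁₁C's),
**`isRecordOfRecord₁₁CB10YZWB8B12_of_isRecordOfRecord₁₁CB10YZWB8B12B13`** (SAME D, SAME w) and `…B8_of_…`, `b4_b5_b6_b7_of_…`, `…_rebind_of_isRecordOfRecord₁₁C`,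
`leaves_iff_of_…` (seven leaves), `leaf_b13_iff_of_…`, `b13_main_iff_of_…` (N10 at the record: «b9 → b10 → b11 → b12 → B13LeafOfRecord»), `b13_main_iff_bundles_of_…`
(every in-edge in its pinned reading), `b13_main_of_…_of_slots`.

FAMILY FORM (pub-balaban an4's (D4) wall, [I] (1.21)): the step of record is a `def` for EVERY layer, parametric in the fine ∕ coarse torus through `lam.n`;
a (1.21) sequence T ↗ ℤ⁴ is a sequence of layers `lamSeq : ℕ → ResidB13 θ` with `(lamSeq m).n ↗` and `W m := (WtOfRecord θ (lamSeq m)).toTorusStep`; the record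
predicate fixes ONE layer per run (today's one-step binding).  NOT HERE (located): the family-carrying restate of `S13` (restate window); the ₁₂ copy (R457 repair
lane, node00-def g32's t4: `11 ↦ 12` once `Record12` lands); the sub-family [B8] variant `…B8subB12B13` (one `rfl`-lift of this module over g32's `…B8subB12`).

HONEST FRAMING: definitions + kernel bookkeeping (`rfl` ∕ `Iff.rfl` ∕ transport); NO estimate; nothing of Bałaban's asserted or constructed; N10 NOT
discharged; counts unmoved; one finite T⁴ programme at fixed ε, Bałaban as printed — NOT continuum ∕ ℝ⁴ ∕ infinite volume ∕ OS ∕ mass gap ∕ Clay.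
No `sorry`, no `axiom`, no `opaque`, no `instance` declaration (structure-field instances registered by `attribute [instance]`, as `Node00/Carriers.lean`),
no `notation`. -/
noncomputable section

namespace Literature.MathematicalPhysics.QuantumFieldTheory.Balaban1983to89.Node00

open T4Continuum AveragingRT T4FiniteEpsInhabited FlowStep FlowStepRuns DagBinding T4DatumAssembly
open B8LeafKnitRS (B8LeafRS)
open scoped Matrix.Norms.L2Operator
open Literature.MathematicalPhysics.QuantumFieldTheory.Balaban1983to89.TreeLengthTorus (TDom TPt tsys IsTDom TFaceConnected TLinked)
open Literature.MathematicalPhysics.QuantumFieldTheory.Balaban1983to89.B13Lemma3TorusData (TBond)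
open Literature.MathematicalPhysics.QuantumFieldTheory.Balaban1983to89.B13Lemma3Torus (TwoTorusStep)
open Literature.MathematicalPhysics.QuantumFieldTheory.Balaban1983to89.B13Lemma3TorusTerms (terms)
open Literature.MathematicalPhysics.QuantumFieldTheory.Balaban1983to89.B13Lemma3TorusSocket (TermDomination)
open Literature.MathematicalPhysics.QuantumFieldTheory.Balaban1983to89.B13PkScaling (Qop scaled)

/-! ## §1. The residual term layer, the two-scale torus step of record, the constants of record, the pinned group and its faces -/

section Group

variable (θ : Stage3Params)

/-- **The residual [B13] term layer at Stage-3 parameters `θ`** (DATA, no law): everything of the step (V′_k, V_k, Q, V″_k, H, E^{(k+1)}) that the record's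
parameters do not determine by a tree object — the torus ∕ step indices, the configuration space with its complex normed structure, the bond index type and
bond variables, the spaces (1.34) ∕ p. 15, the (1.33) index families and TERMS, the curvature terms, the one-plaquette data of (1.40)–(1.42), the terms of H,
the pieces E^{(k+1)} ∕ Elog, the predicates of gauge invariance ∕ (I.1.7) ∕ the Lemma-3 restriction sentence, and the constants but `L`.  Block size of the
tori = `θ.ℓ₆ + 1 = θ.L`. [cite: Balaban1988RG2Cluster, (1.33)–(1.35) p.9, (1.40)–(1.43) pp.10–11, (2.9)–(2.14) pp.14–15, p.21] -/
structure ResidB13 where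
  /-- coarse torus: `n + 1` LM-cubes per direction (fine torus: `(θ.ℓ₆+1)·(n+1)` M-cubes per direction) -/
  n : ℕ
  /-- the step index k of the step carried by the run's binding -/
  k : ℕ
  /-- the configurations (𝐔, 𝐉, B) (complexified), as a complex normed space -/
  Φ : Type
  [normedΦ : NormedAddCommGroup Φ]
  [spaceΦ : NormedSpace ℂ Φ]
  /-- the bonds b ∈ Λ carrying the fluctuation variable B -/
  Bond : Type
  [finBond : Fintype Bond]
  /-- the space (1.34) of Y ∈ 𝐃_k -/
  sp1 : TDom 4 ((θ.ℓ₆ + 1) * (n + 1)) → Set Φ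
  /-- the space Uᶜ_{k+1}(·, α₀, α₁) of p. 15 of Z ∈ 𝐃_{k+1} -/
  sp2 : TDom 4 (n + 1) → Set Φ
  /-- the bond variables B(b) -/
  Bv : Φ → Bond → ℂ
  /-- (1.33): anchors □₀ ⊂ Y -/
  S0 : TDom 4 ((θ.ℓ₆ + 1) * (n + 1)) → Finset (TPt 4 ((θ.ℓ₆ + 1) * (n + 1)))
  /-- (1.33): the cubes Y₀ ranges over, per anchor -/
  F : TDom 4 ((θ.ℓ₆ + 1) * (n + 1)) → TPt 4 ((θ.ℓ₆ + 1) * (n + 1)) → Finset (TPt 4 ((θ.ℓ₆ + 1) * (n + 1)))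
  /-- (1.33): the j-cubes □′ -/
  Sq : TDom 4 ((θ.ℓ₆ + 1) * (n + 1)) → TPt 4 ((θ.ℓ₆ + 1) * (n + 1)) → (j : ℕ) →
    Finset (TPt 4 ((θ.ℓ₆ + 1) ^ (k - j) * ((θ.ℓ₆ + 1) * (n + 1))))
  /-- (1.33): the j-domains X -/
  SX : TDom 4 ((θ.ℓ₆ + 1) * (n + 1)) → TPt 4 ((θ.ℓ₆ + 1) * (n + 1)) → (j : ℕ) →
    TPt 4 ((θ.ℓ₆ + 1) ^ (k - j) * ((θ.ℓ₆ + 1) * (n + 1))) → Finset (TDom 4 ((θ.ℓ₆ + 1) ^ (k - j) * ((θ.ℓ₆ + 1) * (n + 1))))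
  /-- (1.33): the terms of (1.25)–(1.32) localized in Y -/
  T : TDom 4 ((θ.ℓ₆ + 1) * (n + 1)) → TPt 4 ((θ.ℓ₆ + 1) * (n + 1)) → Finset (TPt 4 ((θ.ℓ₆ + 1) * (n + 1))) → (j : ℕ) →
    TPt 4 ((θ.ℓ₆ + 1) ^ (k - j) * ((θ.ℓ₆ + 1) * (n + 1))) → TDom 4 ((θ.ℓ₆ + 1) ^ (k - j) * ((θ.ℓ₆ + 1) * (n + 1))) → Φ → ℂ
  /-- (1.33), (I.3.7)-chain part: anchors -/
  Sc : TDom 4 ((θ.ℓ₆ + 1) * (n + 1)) → Finset (TPt 4 ((θ.ℓ₆ + 1) * (n + 1)))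
  /-- (1.33), (I.3.7)-chain part: j-cubes -/
  Sq' : TDom 4 ((θ.ℓ₆ + 1) * (n + 1)) → TPt 4 ((θ.ℓ₆ + 1) * (n + 1)) → (j : ℕ) →
    Finset (TPt 4 ((θ.ℓ₆ + 1) ^ (k - j) * ((θ.ℓ₆ + 1) * (n + 1))))
  /-- (1.33), (I.3.7)-chain part: j-domains -/
  SX' : TDom 4 ((θ.ℓ₆ + 1) * (n + 1)) → TPt 4 ((θ.ℓ₆ + 1) * (n + 1)) → (j : ℕ) →
    TPt 4 ((θ.ℓ₆ + 1) ^ (k - j) * ((θ.ℓ₆ + 1) * (n + 1))) → Finset (TDom 4 ((θ.ℓ₆ + 1) ^ (k - j) * ((θ.ℓ₆ + 1) * (n + 1))))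
  /-- (1.33), (I.3.7)-chain part: terms -/
  T' : TDom 4 ((θ.ℓ₆ + 1) * (n + 1)) → TPt 4 ((θ.ℓ₆ + 1) * (n + 1)) → (j : ℕ) →
    TPt 4 ((θ.ℓ₆ + 1) ^ (k - j) * ((θ.ℓ₆ + 1) * (n + 1))) → TDom 4 ((θ.ℓ₆ + 1) ^ (k - j) * ((θ.ℓ₆ + 1) * (n + 1))) → Φ → ℂ
  /-- (1.41)–(1.42): the curvature terms, V″_k(Y) − V′_k(Y) -/
  Gl : TDom 4 ((θ.ℓ₆ + 1) * (n + 1)) → Φ → ℂ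
  /-- (1.40): the one-plaquette variable space -/
  E : Type
  [normedE : NormedAddCommGroup E]
  [spaceE : NormedSpace ℂ E]
  /-- (1.41): the plaquette index type and the plaquettes of Y -/
  ι₂ : Type
  s : TDom 4 ((θ.ℓ₆ + 1) * (n + 1)) → Finset ι₂
  /-- (1.40)–(1.41): the one-plaquette terms W(Y, i, (𝐔,𝐉), ·) -/
  Wf : TDom 4 ((θ.ℓ₆ + 1) * (n + 1)) → ι₂ → Φ → E → ℂ
  /-- [I] (2.12): the running coupling g_k of the scaling B = g_k B′ -/
  g : ℂ
  /-- (1.40): the bond-to-plaquette-variable vectors -/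
  e : TDom 4 ((θ.ℓ₆ + 1) * (n + 1)) → Bond → E
  /-- (2.3): bond fineness of the terms of H: `m₃ + 1` -/
  m₃ : ℕ
  /-- (2.9)–(2.14): the terms (𝐃, P) ↦ T_{(𝐃,P)}(Z) of H(Z) -/
  T₃ : (Z : TDom 4 (n + 1)) → Finset (TDom 4 ((θ.ℓ₆ + 1) * (n + 1))) × Finset (TBond 4 (m₃ + 1) ((θ.ℓ₆ + 1) * (n + 1))) → Φ → ℂ
  /-- p. 21: E^{(k+1)}(X) -/
  Ek1 : TDom 4 (n + 1) → Φ → ℂ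
  /-- p. 21: the log Z^{(k)} terms localized in X -/
  Elog : TDom 4 (n + 1) → Φ → ℂ
  /-- (I.3.29): invariance under gauge transformations -/
  GaugeInv : (Φ → ℂ) → Prop
  /-- (I.1.7): the inductive representation -/
  Repr17 : Prop
  /-- Lemma 3's «under all the above restrictions on the constants» (cell census R1–R24; located form reads g_k) -/
  Restr : Prop
  /-- the constants of [II] but `L` (`L` := the run's block size, `c13OfRecord`) -/
  c : B13.Consts

attribute [instance] ResidB13.normedΦ ResidB13.spaceΦ ResidB13.finBond ResidB13.normedE ResidB13.spaceE

variable {θ}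

namespace ResidB13

variable (lam : ResidB13 θ)

/-- (1.40): the plaquette variable `rd Y φ = Σ_b B(b) • e Y b`. [cite: Balaban1988RG2Cluster, (1.40) p.10] -/
def rd (Y : TDom 4 ((θ.ℓ₆ + 1) * (lam.n + 1))) (φ : lam.Φ) : lam.E := ∑ b, lam.Bv φ b • lam.e Y b

/-- (1.33): V′_k(Y) := THE DOUBLE SUM OF ITS TERMS (the shape of `B13NodeTorusTermwise.b13Leaf_twoTorus_termwise`'s `h133`). [cite: Balaban1988RG2Cluster, (1.33) p.9] -/
def Vp (Y : TDom 4 ((θ.ℓ₆ + 1) * (lam.n + 1))) : lam.Φ → ℂ :=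
  (∑ a ∈ lam.S0 Y, ∑ X ∈ (lam.F Y a).powerset, ∑ j ∈ Finset.range (lam.k + 1), ∑ q ∈ lam.Sq Y a j, ∑ x ∈ lam.SX Y a j q, lam.T Y a X j q x) +
    (∑ a ∈ lam.Sc Y, ∑ j ∈ Finset.range (lam.k + 1), ∑ q ∈ lam.Sq' Y a j, ∑ x ∈ lam.SX' Y a j q, lam.T' Y a j q x)

/-- (1.41)–(1.42): V″_k(Y) := V′_k(Y) + the curvature terms. [cite: Balaban1988RG2Cluster, (1.41)–(1.42) p.11] -/
def Vpp (Y : TDom 4 ((θ.ℓ₆ + 1) * (lam.n + 1))) : lam.Φ → ℂ := fun φ => lam.Vp Y φ + lam.Gl Y φ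

/-- (1.41): V_k(Y) := Σ_{i ∈ s Y} (scaled g W(Y,i,φ,·))(rd Y φ) + V″_k(Y). [cite: Balaban1988RG2Cluster, (1.41) p.11; Balaban1987RG1, (2.12) p.268] -/
def V (Y : TDom 4 ((θ.ℓ₆ + 1) * (lam.n + 1))) : lam.Φ → ℂ := fun φ => (∑ i ∈ lam.s Y, scaled lam.g (lam.Wf Y i φ) (lam.rd Y φ)) + lam.Vpp Y φ

/-- (1.40)–(1.42): the matrix elements Q(Y, B, b, b′) := 2·Σ_{i ∈ s Y} Q_{scaled g W}(rd Y φ)(e Y b, e Y b′). [cite: Balaban1988RG2Cluster, (1.40)–(1.42) pp.10–11] -/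
def Q (Y : TDom 4 ((θ.ℓ₆ + 1) * (lam.n + 1))) (φ : lam.Φ) (b b' : lam.Bond) : ℂ :=
  2 * ∑ i ∈ lam.s Y, Qop (scaled lam.g (lam.Wf Y i φ)) (lam.rd Y φ) (lam.e Y b) (lam.e Y b')

/-- (2.9)–(2.14): H(Z) := THE SUM OF ITS TERMS (𝐃, P) over `B13Lemma3TorusTerms.terms`. [cite: Balaban1988RG2Cluster, (2.9) p.14 and (2.14) p.15] -/
def H (Z : TDom 4 (lam.n + 1)) (φ : lam.Φ) : ℂ := ∑ t ∈ terms (θ.ℓ₆ + 1) (lam.m₃ + 1) Z, lam.T₃ Z t φ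

/-- Analyticity on a set of configurations := `AnalyticOnNhd ℂ` on the complex normed configuration space ([I] §3). [cite: Balaban1987RG1, §3 p.283 (analyticity in (𝐔,𝐉))] -/
def Analytic (f : lam.Φ → ℂ) (s : Set lam.Φ) : Prop := AnalyticOnNhd ℂ f s

/-- Unfolding (`Iff.rfl`). [cite: Balaban1987RG1, §3 p.283 (analyticity in (𝐔,𝐉); bookkeeping)] -/
theorem analytic_iff (f : lam.Φ → ℂ) (s : Set lam.Φ) : lam.Analytic f s ↔ AnalyticOnNhd ℂ f s := Iff.rfl

/-- Closure under addition (the closers' `hAdd`, DISCHARGED). [cite: Balaban1987RG1, §3 p.283 (analyticity in (𝐔,𝐉); bookkeeping)] -/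
theorem analytic_add {f₁ f₂ : lam.Φ → ℂ} {s : Set lam.Φ} (h₁ : lam.Analytic f₁ s) (h₂ : lam.Analytic f₂ s) : lam.Analytic (f₁ + f₂) s :=
  AnalyticOnNhd.add h₁ h₂

/-- The zero function is analytic (the closers' `hZero`, DISCHARGED). [cite: Balaban1987RG1, §3 p.283 (analyticity in (𝐔,𝐉); bookkeeping)] -/
theorem analytic_zero (s : Set lam.Φ) : lam.Analytic 0 s := fun _ _ => analyticAt_const

/-- Constants are analytic. [cite: Balaban1987RG1, §3 p.283 (analyticity in (𝐔,𝐉); bookkeeping)] -/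
theorem analytic_const (a : ℂ) (s : Set lam.Φ) : lam.Analytic (fun _ => a) s := fun _ _ => analyticAt_const

end ResidB13

variable (θ)

/-- **The [B13] constants of record**: the residual letters with `L :=` the run's block size `θ.ℓ₆ + 1 = θ.L`. [cite: Balaban1988RG2Cluster, §§1–2 pp.3–21 (constants)] -/
def c13OfRecord (lam : ResidB13 θ) : B13.Consts := { lam.c with L := θ.ℓ₆ + 1 }

/-- `(c13OfRecord θ lam).L = θ.ℓ₆ + 1` (`rfl`; the closers' `hLc : c.L = L`). [cite: Balaban1988RG2Cluster, p.20 (bookkeeping)] -/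
@[simp] theorem c13OfRecord_L (lam : ResidB13 θ) : (c13OfRecord θ lam).L = θ.ℓ₆ + 1 := rfl

/-- `(c13OfRecord θ lam).L = θ.L`. [cite: Balaban1988RG2Cluster, p.20 (bookkeeping)] -/
theorem c13OfRecord_L_eq_L (lam : ResidB13 θ) : (c13OfRecord θ lam).L = θ.L := θ.hℓ₆

/-- The closers' `hL8 : 8 ≤ c.L` at the record reads `8 ≤ θ.L`. [cite: Balaban1988RG2Cluster, p.20 (bookkeeping)] -/
theorem eight_le_c13OfRecord_L_iff (lam : ResidB13 θ) : 8 ≤ (c13OfRecord θ lam).L ↔ 8 ≤ θ.L := by rw [c13OfRecord_L_eq_L]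

/-- **THE TWO-SCALE TORUS STEP OF RECORD** `WtOfRecord θ lam : TwoTorusStep 4 (θ.ℓ₆ + 1) (lam.n + 1)`: carriers = the nested tori; `volk := card`;
`Analytic := AnalyticOnNhd ℂ`; `Vp ∕ Vpp ∕ V ∕ Q ∕ H` := the displayed sums of the residual terms; every other field the residual layer's.
[cite: Balaban1988RG2Cluster, (1.33)–(1.35) p.9, (1.40)–(1.43) pp.10–11, (2.9)–(2.14) pp.14–15, Lemma 3 p.20, p.21] -/
def WtOfRecord (lam : ResidB13 θ) : TwoTorusStep 4 (θ.ℓ₆ + 1) (lam.n + 1) where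
  volk := fun Y => Y.1.card
  Φ := lam.Φ
  Bond := lam.Bond
  finBond := lam.finBond
  sp1 := lam.sp1
  sp2 := lam.sp2
  Bv := lam.Bv
  Vp := lam.Vp
  V := lam.V
  Q := lam.Q
  Vpp := lam.Vpp
  H := lam.H
  Ek1 := lam.Ek1
  Elog := lam.Elog
  Analytic := lam.Analytic
  GaugeInv := lam.GaugeInv
  Repr17 := lam.Repr17
  Restr := lam.Restr

variable {θ}
variable (lam : ResidB13 θ)

/-- Face `hvolk` (`rfl`): M⁻⁴|Y| = `Y.1.card`. [cite: Balaban1988RG2Cluster, (1.43) p.11] -/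
theorem WtOfRecord_volk : (WtOfRecord θ lam).volk = fun Y => Y.1.card := rfl

/-- Face `h133` (`rfl`): V′_k(Y) IS the (1.33) double sum of its terms. [cite: Balaban1988RG2Cluster, (1.33) p.9] -/
theorem WtOfRecord_Vp (Y : TDom 4 ((θ.ℓ₆ + 1) * (lam.n + 1))) :
    (WtOfRecord θ lam).Vp Y =
      (∑ a ∈ lam.S0 Y, ∑ X ∈ (lam.F Y a).powerset, ∑ j ∈ Finset.range (lam.k + 1), ∑ q ∈ lam.Sq Y a j, ∑ x ∈ lam.SX Y a j q, lam.T Y a X j q x) +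
      (∑ a ∈ lam.Sc Y, ∑ j ∈ Finset.range (lam.k + 1), ∑ q ∈ lam.Sq' Y a j, ∑ x ∈ lam.SX' Y a j q, lam.T' Y a j q x) := rfl

/-- Face `hVpp` (`rfl`): V″_k(Y) = V′_k(Y) + Gl(Y). [cite: Balaban1988RG2Cluster, (1.41)–(1.42) p.11] -/
theorem WtOfRecord_Vpp (Y : TDom 4 ((θ.ℓ₆ + 1) * (lam.n + 1))) : (WtOfRecord θ lam).Vpp Y = fun φ => (WtOfRecord θ lam).Vp Y φ + lam.Gl Y φ := rfl

/-- Face `hrd` (`rfl`, in the closers' `haveI := Wt.finBond` spelling). [cite: Balaban1988RG2Cluster, (1.40) p.10] -/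
theorem WtOfRecord_rd (Y : TDom 4 ((θ.ℓ₆ + 1) * (lam.n + 1))) (φ : lam.Φ) :
    lam.rd Y φ = haveI := (WtOfRecord θ lam).finBond; ∑ b, (WtOfRecord θ lam).Bv φ b • lam.e Y b := rfl

/-- Face `hV` (`rfl`): V_k(Y) = Σ_i scaled-W + V″_k(Y). [cite: Balaban1988RG2Cluster, (1.41) p.11] -/
theorem WtOfRecord_V (Y : TDom 4 ((θ.ℓ₆ + 1) * (lam.n + 1))) :
    (WtOfRecord θ lam).V Y = fun φ => (∑ i ∈ lam.s Y, scaled lam.g (lam.Wf Y i φ) (lam.rd Y φ)) + (WtOfRecord θ lam).Vpp Y φ := rfl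

/-- Face `hQ` (`rfl`). [cite: Balaban1988RG2Cluster, (1.40)–(1.42) pp.10–11] -/
theorem WtOfRecord_Q (Y : TDom 4 ((θ.ℓ₆ + 1) * (lam.n + 1))) (φ : lam.Φ) (b b' : lam.Bond) :
    (WtOfRecord θ lam).Q Y φ b b' = 2 * ∑ i ∈ lam.s Y, Qop (scaled lam.g (lam.Wf Y i φ)) (lam.rd Y φ) (lam.e Y b) (lam.e Y b') := rfl

/-- Face (`rfl`): H(Z) IS the sum of its terms. [cite: Balaban1988RG2Cluster, (2.9) p.14 and (2.14) p.15] -/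
theorem WtOfRecord_H (Z : TDom 4 (lam.n + 1)) (φ : lam.Φ) : (WtOfRecord θ lam).H Z φ = ∑ t ∈ terms (θ.ℓ₆ + 1) (lam.m₃ + 1) Z, lam.T₃ Z t φ := rfl

/-- Face (`Iff.rfl`): analyticity at the step of record is `AnalyticOnNhd ℂ`. [cite: Balaban1987RG1, §3 p.283] -/
theorem WtOfRecord_analytic_iff (f : lam.Φ → ℂ) (s : Set lam.Φ) : (WtOfRecord θ lam).Analytic f s ↔ AnalyticOnNhd ℂ f s := Iff.rfl

set_option maxHeartbeats 400000 in
/-- Face `hH`: TERMWISE DOMINATION HOLDS at the step of record (H = Σ terms; `B13NodeKnitRecord5C.termDomination_of_eq`). [cite: Balaban1988RG2Cluster, (2.9) p.14 and (2.14) p.15] -/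
theorem termDomination_WtOfRecord : TermDomination (lam.m₃ + 1) (WtOfRecord θ lam) lam.T₃ :=
  B13NodeKnitRecord5C.termDomination_of_eq (lam.m₃ + 1) (WtOfRecord θ lam) lam.T₃ fun _ _ => rfl

variable (θ)

/-- **The [B13] leaf at the group of record**: Lemma 1 ∧ Lemma 2 ∧ Lemma 3 AS PRINTED (`B13.Lemma1Printed ∕ Lemma2Printed ∕ Lemma3Printed`) for the step of record and
the constants of record. [cite: Balaban1988RG2Cluster, Lemma 1 p.9, Lemma 2 p.11, Lemma 3 p.20] -/
def B13LeafOfRecord (lam : ResidB13 θ) : Prop :=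
  B13.Lemma1Printed (WtOfRecord θ lam).toStepData (c13OfRecord θ lam) ∧ B13.Lemma2Printed (WtOfRecord θ lam).toStepData (c13OfRecord θ lam) ∧
    B13.Lemma3Printed (WtOfRecord θ lam).toStepData (c13OfRecord θ lam)

/-- **The carrier bundle with its [B13] group := the group of record** (every other group verbatim). [cite: Balaban1988RG2Cluster, Lemmas 1–3 pp.9–20 (objects of record)] -/
def _root_.Literature.MathematicalPhysics.QuantumFieldTheory.Balaban1983to89.DagBinding.PrintedCarriersR.withB13OfRecord (X : PrintedCarriersR)
    (θ : Stage3Params) (lam : ResidB13 θ) : PrintedCarriersR :=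
  { X with S13 := (WtOfRecord θ lam).toStepData, c13 := c13OfRecord θ lam }

variable (X : PrintedCarriersR) (lam : ResidB13 θ)

/-- The pinned step data (`rfl`). [cite: Balaban1988RG2Cluster, Lemmas 1–3 pp.9–20 (bookkeeping)] -/
theorem withB13OfRecord_S13 : (X.withB13OfRecord θ lam).S13 = (WtOfRecord θ lam).toStepData := rfl

/-- The pinned constants (`rfl`). [cite: Balaban1988RG2Cluster, §§1–2 (bookkeeping)] -/
theorem withB13OfRecord_c13 : (X.withB13OfRecord θ lam).c13 = c13OfRecord θ lam := rfl

/-- The [B10] runs are untouched (`rfl`). [cite: Balaban1985UV3, (1)–(5) p.256 (bookkeeping)] -/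
theorem withB13OfRecord_runs10 : (X.withB13OfRecord θ lam).runs10 = X.runs10 := rfl

/-- The [B12] frame is untouched (`rfl`; the sibling [B12] pin commutes with this one). [cite: Balaban1987RG1, Lemma 4 p.279 (bookkeeping)] -/
theorem withB13OfRecord_F12 : (X.withB13OfRecord θ lam).F12 = X.F12 := rfl

/-- The [B12] constants are untouched (`rfl`). [cite: Balaban1987RG1, Lemma 4 p.279 (bookkeeping)] -/
theorem withB13OfRecord_c12 : (X.withB13OfRecord θ lam).c12 = X.c12 := rfl

/-- **The leaf `b13` over the pinned bundle IS `B13LeafOfRecord`** (`Iff.rfl`). [cite: Balaban1988RG2Cluster, Lemma 1 p.9, Lemma 2 p.11, Lemma 3 p.20] -/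
theorem b13Leaf_withB13OfRecord_iff :
    (B13.Lemma1Printed (X.withB13OfRecord θ lam).S13 (X.withB13OfRecord θ lam).c13 ∧
      B13.Lemma2Printed (X.withB13OfRecord θ lam).S13 (X.withB13OfRecord θ lam).c13 ∧
        B13.Lemma3Printed (X.withB13OfRecord θ lam).S13 (X.withB13OfRecord θ lam).c13) ↔ B13LeafOfRecord θ lam := Iff.rfl

/-- The pin commutes with the [B10] run substitution (`rfl`). [cite: Balaban1985UV3, (1)–(5) p.256 (bookkeeping)] -/
theorem withRuns10_withB13OfRecord (r : X.I10 → B10.RunData) : (X.withRuns10 r).withB13OfRecord θ lam = (X.withB13OfRecord θ lam).withRuns10 r := rfl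

/-- The pin commutes with the [B8] pin (`rfl`; field-disjoint). [cite: Balaban1985RegularSpaces, Thm 2 p.83 (bookkeeping)] -/
theorem withB8OfRecord_withB13OfRecord (lam8 : ResidB8 θ) :
    (X.withB8OfRecord θ lam8).withB13OfRecord θ lam = (X.withB13OfRecord θ lam).withB8OfRecord θ lam8 := rfl

/-- The Stage-3 substitution does not touch the [B13] group (`rfl`, `CarriersFrame.carriers₁_groupB13`). [cite: Balaban1988RG2Cluster, Lemmas 1–3 (bookkeeping)] -/
theorem carriers₃_withB13OfRecord (θ₃ : Stage3Params) : carriers₃ θ₃ (X.withB13OfRecord θ lam) = (carriers₃ θ₃ X).withB13OfRecord θ lam := rfl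

/-- A one-cube localization domain of a torus (for the honesty witnesses). [folklore] -/
private theorem isTDom_singleton {d M : ℕ} [NeZero M] (a : TPt d M) : IsTDom ({a} : Finset (TPt d M)) :=
  ⟨Finset.singleton_nonempty a, fun x hx y hy => by
    rw [Finset.mem_singleton] at hx hy
    subst hx hy
    exact Relation.ReflTransGen.refl⟩

/-- The junk constants (every letter 0). [folklore] -/
private def junkConsts : B13.Consts := ⟨0, 0, 0, 0, 0, 0, 0, 0, 0, 0, 0, 0, 0, 0, 0, 0, 0, 0, 0, 0, 0⟩

/-- A degenerate residual layer with prescribed spaces and gauge-invariance predicate (everything else trivial: one-point tori indices, Φ = E = ℂ, no terms).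
[folklore] -/
private def junkLayer (S1 : TDom 4 ((θ.ℓ₆ + 1) * (0 + 1)) → Set ℂ) (S2 : TDom 4 (0 + 1) → Set ℂ) (G : (ℂ → ℂ) → Prop) : ResidB13 θ where
  n := 0
  k := 0
  Φ := ℂ
  Bond := PUnit
  sp1 := S1
  sp2 := S2
  Bv := fun _ _ => 0
  S0 := fun _ => ∅
  F := fun _ _ => ∅
  Sq := fun _ _ _ => ∅
  SX := fun _ _ _ _ => ∅
  T := fun _ _ _ _ _ _ _ => 0
  Sc := fun _ => ∅
  Sq' := fun _ _ _ => ∅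
  SX' := fun _ _ _ _ => ∅
  T' := fun _ _ _ _ _ _ => 0
  Gl := fun _ _ => 0
  E := ℂ
  ι₂ := PUnit
  s := fun _ => ∅
  Wf := fun _ _ _ _ => 0
  g := 1
  e := fun _ _ => 0
  m₃ := 0
  T₃ := fun _ _ _ => 0
  Ek1 := fun _ _ => 0
  Elog := fun _ _ => 0
  GaugeInv := G
  Repr17 := True
  Restr := True
  c := junkConsts

/-- The residual layer is inhabited (degenerately) — the definitions are not vacuous. [cite: Balaban1988RG2Cluster, Lemmas 1–3 pp.9–20 (bookkeeping)] -/
theorem nonempty_residB13 : Nonempty (ResidB13 θ) := ⟨junkLayer θ (fun _ => ∅) (fun _ => ∅) fun _ => True⟩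

/-- **HONESTY (R433 species): the ∀-form of N10 over this pin is junk-REFUTABLE through the residual layer** — a layer whose gauge-invariance predicate is `False`
violates Lemma 2's last clause at the one-cube domain, so `B13LeafOfRecord θ lam` fails for SOME `lam` at EVERY `θ`. [cite: Balaban1988RG2Cluster, Lemma 2 p.11 (the gauge-invariance clause)] -/
theorem exists_residB13_not_b13LeafOfRecord : ∃ lam : ResidB13 θ, ¬ B13LeafOfRecord θ lam := by
  refine ⟨junkLayer θ (fun _ => ∅) (fun _ => ∅) fun _ => False, fun h => ?_⟩
  obtain ⟨-, ⟨-, -, -, -, hG⟩, -⟩ := h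
  exact (hG ⟨{fun _ => 0}, isTDom_singleton _⟩).1

/-- **HONESTY: the ∃-form is junk-INHABITABLE** — with EMPTY spaces `sp1 = sp2 = ∅` (and `GaugeInv := True`) every clause of the three printed lemmas is vacuous, so
`B13LeafOfRecord θ lam` HOLDS for SOME `lam` at EVERY `θ`; an «inhabited-at» audit of a record of this module must therefore check the spaces non-empty (and `Restr`
satisfiable), exactly ref-B's A1–A6. [cite: Balaban1988RG2Cluster, (1.34) p.9 and p.15 (the spaces are non-empty in print)] -/
theorem exists_residB13_b13LeafOfRecord : ∃ lam : ResidB13 θ, B13LeafOfRecord θ lam := by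
  refine ⟨junkLayer θ (fun _ => ∅) (fun _ => ∅) fun _ => True, ?_⟩
  refine ⟨⟨fun Y => ?_, fun Y φ hφ => ?_⟩, ⟨fun Y => ?_, fun Y φ hφ => ?_, fun Y φ b b' hφ => ?_, fun Y φ hφ => ?_, fun Y => ⟨trivial, trivial, trivial⟩⟩,
    fun _ Z φ hφ => ?_⟩
  · exact fun _ h => h.elim
  · exact hφ.elim
  · exact fun _ h => h.elim
  · exact hφ.elim
  · exact hφ.elim
  · exact hφ.elim
  · exact hφ.elim

end Group

/-! ## §2. The run-indexed pinned bundle `XB13OfRecord` and N10 at a Stage-5 `X`-re-binding by it, BY NAME (`Record11Carriers.Stage5Params.rebindX`) -/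

section Rebind

variable (F : T4Family) (N : ℕ) [NeZero N]

/-- **The run-indexed carrier bundle with its [B13] group := the group of record** — one residual term layer PER RUN (today's binding carries one step per run):
`XB13OfRecord θ₃ lam X P := (X P).withB13OfRecord θ₃ (lam P)` — the literal update `{ X P with S13 := (WtOfRecord θ₃ (lam P)).toStepData, c13 := c13OfRecord θ₃ (lam P) }` of
the N10 consumers' `rebindS13` shape. [cite: Balaban1988RG2Cluster, Lemmas 1–3 pp.9–20 (objects of record, Stage 3′(X.B13))] -/
def XB13OfRecord (θ₃ : Stage3Params) (lam : B12.RunParams → ResidB13 θ₃) (X : B12.RunParams → PrintedCarriersR) : B12.RunParams → PrintedCarriersR :=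
  fun P => (X P).withB13OfRecord θ₃ (lam P)

/-- Unfolding (`rfl`). [cite: Balaban1988RG2Cluster, Lemmas 1–3 (bookkeeping)] -/
theorem XB13OfRecord_apply (θ₃ : Stage3Params) (lam : B12.RunParams → ResidB13 θ₃) (X : B12.RunParams → PrintedCarriersR) (P : B12.RunParams) :
    XB13OfRecord θ₃ lam X P = { X P with S13 := (WtOfRecord θ₃ (lam P)).toStepData, c13 := c13OfRecord θ₃ (lam P) } := rfl

/-- The [B10] runs of the pinned bundle are the old ones (`rfl`). [cite: Balaban1985UV3, (1)–(5) p.256 (bookkeeping)] -/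
theorem XB13OfRecord_runs10 (θ₃ : Stage3Params) (lam : B12.RunParams → ResidB13 θ₃) (X : B12.RunParams → PrintedCarriersR) (P : B12.RunParams) :
    (XB13OfRecord θ₃ lam X P).runs10 = (X P).runs10 := rfl

/-- The [B12] frame ∕ constants of the pinned bundle are the old ones (`rfl` ×2: the sibling [B12] pin commutes with this one). [cite: Balaban1987RG1, Lemma 4 p.279 (bookkeeping)] -/
theorem XB13OfRecord_F12 (θ₃ : Stage3Params) (lam : B12.RunParams → ResidB13 θ₃) (X : B12.RunParams → PrintedCarriersR) (P : B12.RunParams) :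
    (XB13OfRecord θ₃ lam X P).F12 = (X P).F12 ∧ (XB13OfRecord θ₃ lam X P).c12 = (X P).c12 := ⟨rfl, rfl⟩

/-- The two `X`-substitutions commute: [B12]-then-[B13] = [B13]-then-[B12] (`rfl`, field-disjoint updates). [cite: Balaban1987RG1, Lemma 4 p.279; Balaban1988RG2Cluster, Lemmas 1–3 (bookkeeping)] -/
theorem withB12_withB13OfRecord (X : PrintedCarriersR) (θ₃ : Stage3Params) (lam : ResidB13 θ₃) (F12 : B12Sec2to5.Lemma4Frame) (c12 : B12Sec2to5.Lemma4Consts) :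
    (X.withB13OfRecord θ₃ lam).withB12 F12 c12 = (X.withB12 F12 c12).withB13OfRecord θ₃ lam := rfl

variable {F N}

/-- **N10 AT A RUN BOUND TO THE C-BINDING OF A STAGE-5 VIEW RE-BOUND BY `XB13OfRecord`** = `B13NodeKnitRecord5C.b13_main_iff_res₅C` BY NAME: «b9 → b10 → b11 → b12 → b13» with `b13`
THE LEAF AT THE GROUP OF RECORD, the in-edges at the view's carriers. [cite: Balaban1988RG2Cluster, Lemmas 1–3 pp.9, 11, 20 (the node at the objects of record)] -/
theorem b13_main_iff_rebindX_XB13OfRecord (φ : Stage5Params F N) (lam : B12.RunParams → ResidB13 φ.toStage3Params) (X : B12.RunParams → PrintedCarriersR) (w : WorldP)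
    (P : B12.RunParams) (hup : w.up P = upOfRecord₅C F N (φ.rebindX F N (XB13OfRecord φ.toStage3Params lam X)) P) :
    Dag.B13_main (leavesP w P) ↔
      (B9LeafX (φ.res.Y P) → (B10.Thm1PrintedCompact (X P).runs10 ∧ B10.Thm2Printed (X P).runs10) → B11Leaf (φ.res.Z P) →
        B12Sec2to5.Lemma4Printed (X P).F12 (X P).c12 → B13LeafOfRecord φ.toStage3Params (lam P)) :=
  B13NodeKnitRecord5C.b13_main_iff_res₅C F N (φ.rebindX F N (XB13OfRecord φ.toStage3Params lam X)) w P hup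

/-- The leaf alone (`B13NodeKnitRecord5C.b13_leaf_iff_res₅C` by name). [cite: Balaban1988RG2Cluster, Lemmas 1–3 pp.9, 11, 20 (bookkeeping)] -/
theorem b13_leaf_iff_rebindX_XB13OfRecord (φ : Stage5Params F N) (lam : B12.RunParams → ResidB13 φ.toStage3Params) (X : B12.RunParams → PrintedCarriersR) (w : WorldP)
    (P : B12.RunParams) (hup : w.up P = upOfRecord₅C F N (φ.rebindX F N (XB13OfRecord φ.toStage3Params lam X)) P) :
    (leavesP w P).b13 ↔ B13LeafOfRecord φ.toStage3Params (lam P) :=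
  B13NodeKnitRecord5C.b13_leaf_iff_res₅C F N (φ.rebindX F N (XB13OfRecord φ.toStage3Params lam X)) w P hup

/-- The same node reading under the S-binding `upOfRecord₅CS` (N10 does not read `b8`). [cite: Balaban1988RG2Cluster, Lemmas 1–3 pp.9, 11, 20 (bookkeeping)] -/
theorem b13_main_iff_rebindX_XB13OfRecordS (φ : Stage5Params F N) (lam : B12.RunParams → ResidB13 φ.toStage3Params) (X : B12.RunParams → PrintedCarriersR) (w : WorldP)
    (P : B12.RunParams) (hup : w.up P = upOfRecord₅CS F N (φ.rebindX F N (XB13OfRecord φ.toStage3Params lam X)) P) :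
    Dag.B13_main (leavesP w P) ↔
      (B9LeafX (φ.res.Y P) → (B10.Thm1PrintedCompact (X P).runs10 ∧ B10.Thm2Printed (X P).runs10) → B11Leaf (φ.res.Z P) →
        B12Sec2to5.Lemma4Printed (X P).F12 (X P).c12 → B13LeafOfRecord φ.toStage3Params (lam P)) := by
  show ((w.up P).b9 → (w.up P).b10 → (w.up P).b11 → (w.up P).b12 → (w.up P).b13) ↔ _
  rw [hup]
  exact Iff.rfl

/-- **N10 AT `(w, P)` FROM THE TORUS LEAF TRIPLE AT THE STEP OF RECORD** = `B13NodeKnitRecord5C.b13_main_at_stage5ParamsC_twoTorus` BY NAME with `hS hc := rfl` (the conclusions of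
`B13NodeTorusTermwise.b13Leaf_twoTorus_termwise` ∕ `_primitives` ∕ dag-n10-c's `…_walks` for `Wt := WtOfRecord …`, `c := c13OfRecord …` plug into `hleaf`, their identification hypotheses
`hvolk h133 hVpp hV hQ hrd hH hLc` being §1's faces). [cite: Balaban1988RG2Cluster, Lemma 1 p.9, Lemma 2 p.11, Lemma 3 p.20] -/
theorem b13_main_at_rebindX_XB13OfRecord (φ : Stage5Params F N) (lam : B12.RunParams → ResidB13 φ.toStage3Params) (X : B12.RunParams → PrintedCarriersR) (w : WorldP)
    (P : B12.RunParams) (hup : w.up P = upOfRecord₅C F N (φ.rebindX F N (XB13OfRecord φ.toStage3Params lam X)) P)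
    (hleaf : B9LeafX (φ.res.Y P) → (B10.Thm1PrintedCompact (X P).runs10 ∧ B10.Thm2Printed (X P).runs10) → B11Leaf (φ.res.Z P) →
      B12Sec2to5.Lemma4Printed (X P).F12 (X P).c12 →
        B13.Lemma1Printed (WtOfRecord φ.toStage3Params (lam P)).toStepData (c13OfRecord φ.toStage3Params (lam P)) ∧
          B13.Lemma2Printed (WtOfRecord φ.toStage3Params (lam P)).toStepData (c13OfRecord φ.toStage3Params (lam P)) ∧
            B13.Lemma3Printed (WtOfRecord φ.toStage3Params (lam P)).toStepData (c13OfRecord φ.toStage3Params (lam P))) :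
    Dag.B13_main (leavesP w P) :=
  B13NodeKnitRecord5C.b13_main_at_stage5ParamsC_twoTorus F N (φ.rebindX F N (XB13OfRecord φ.toStage3Params lam X)) w P hup (WtOfRecord φ.toStage3Params (lam P))
    (c13OfRecord φ.toStage3Params (lam P)) rfl rfl hleaf

end Rebind

/-! ## §3. The [B13] pin at Stage 11 (an `X`-re-binding through `Record11Carriers.Stage11Params.rebindX`, UP-SIDE) -/

section Pin11

variable (F : T4Family) (N : ℕ) [NeZero N]

/-- **The [B13] pin of Stage-11 parameters**: `res.X := XB13OfRecord θ.toStage3Params lam res.X`, everything else unchanged (g31's generic `rebindX`, as the sibling [B12] pin).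
[cite: Balaban1988RG2Cluster, Lemmas 1–3 pp.9–20 (objects of record, Stage 3′(X.B13))] -/
def Stage11Params.pinB13 (θ : Stage11Params F N) (lam : B12.RunParams → ResidB13 θ.toStage3Params) : Stage11Params F N :=
  θ.rebindX F N (XB13OfRecord θ.toStage3Params lam θ.res.X)

/-- The pinned carrier family, unfolded (`rfl`). [cite: Balaban1988RG2Cluster, Lemmas 1–3 (bookkeeping)] -/
theorem Stage11Params.pinB13_X (θ : Stage11Params F N) (lam : B12.RunParams → ResidB13 θ.toStage3Params) (P : B12.RunParams) :
    (θ.pinB13 F N lam).res.X P = (θ.res.X P).withB13OfRecord θ.toStage3Params (lam P) := rfl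

/-- The pin touches neither admissibility (`Iff.rfl`) … [cite: Balaban1987RG1, (1.20)–(1.21) p.264 (hypothesis dictionary; bookkeeping)] -/
theorem Stage11Params.pinB13_admissible_iff (θ : Stage11Params F N) (lam : B12.RunParams → ResidB13 θ.toStage3Params) :
    (θ.pinB13 F N lam).Admissible ↔ θ.Admissible := Iff.rfl

/-- … nor the Stage-3 dictionary (`rfl`) … [cite: Balaban1984PropagatorsII, pp.223–250 (bookkeeping)] -/
theorem Stage11Params.pinB13_toStage3Params (θ : Stage11Params F N) (lam : B12.RunParams → ResidB13 θ.toStage3Params) :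
    (θ.pinB13 F N lam).toStage3Params = θ.toStage3Params := rfl

/-- … nor the Stage-9 part but `res.X` (`rfl`, `Record11CarriersB12.Stage9Params.rebindX`) … [cite: Balaban1988Convergent, p.244 (bookkeeping)] -/
theorem Stage11Params.pinB13_toStage9Params (θ : Stage11Params F N) (lam : B12.RunParams → ResidB13 θ.toStage3Params) :
    (θ.pinB13 F N lam).toStage9Params = θ.toStage9Params.rebindX F N (XB13OfRecord θ.toStage3Params lam θ.res.X) := rfl

/-- … nor the sibling's [B12] frame of record (`rfl`: it reads `Rz`, `s2`, `τ9`, not `X`) … [cite: Balaban1987RG1, Lemma 4 (3.53) p.280 (bookkeeping)] -/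
theorem F12OfRecord₁₁_pinB13 (θ : Stage11Params F N) (lam : B12.RunParams → ResidB13 θ.toStage3Params) (lam12 : ResidB12 F N θ.τ9.M) (p : B12.RunParams) :
    F12OfRecord₁₁ F N (θ.pinB13 F N lam) lam12 p = F12OfRecord₁₁ F N θ lam12 p := rfl

/-- … nor its `b12` leaf of record (`Iff.rfl`) … [cite: Balaban1987RG1, Lemma 4 (3.53) p.280 (bookkeeping)] -/
theorem b12LeafOfRecord₁₁_pinB13_iff (θ : Stage11Params F N) (lam : B12.RunParams → ResidB13 θ.toStage3Params) (lam12 : ResidB12 F N θ.τ9.M) (p : B12.RunParams) :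
    B12LeafOfRecord₁₁ F N (θ.pinB13 F N lam) lam12 p ↔ B12LeafOfRecord₁₁ F N θ lam12 p := Iff.rfl

/-- … nor the [IV] bundle of record (`rfl`). [cite: Balaban1989LargeFieldI, (0.2) p.176 (bookkeeping)] -/
theorem WOfRecord₁₁_pinB13 (θ : Stage11Params F N) (lam : B12.RunParams → ResidB13 θ.toStage3Params) (lamW : ResidW F N) :
    WOfRecord₁₁ F N (θ.pinB13 F N lam) lamW = WOfRecord₁₁ F N θ lamW := rfl

variable {F N} in
/-- The Stage-11 provisos transport along the [B13] pin (`Record11CarriersB12.Stage11Params.Provisos₁₁.rebindX`). [cite: Balaban1988Convergent, (2.23)–(2.42) pp.259–262 (bookkeeping)] -/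
theorem Stage11Params.Provisos₁₁.pinB13 {θ : Stage11Params F N} (h : θ.Provisos₁₁) (lam : B12.RunParams → ResidB13 θ.toStage3Params) : (θ.pinB13 F N lam).Provisos₁₁ :=
  h.rebindX _

/-- The Stage-11 view of [B13]-pinned parameters IS the re-bound Stage-11 view (g31's `toStage5₁₁_rebindX`). [cite: Balaban1988Convergent, p.244 (bookkeeping)] -/
theorem Stage11Params.toStage5₁₁_pinB13 (θ : Stage11Params F N) (lam : B12.RunParams → ResidB13 θ.toStage3Params) :
    (θ.pinB13 F N lam).toStage5₁₁ F N = (θ.toStage5₁₁ F N).rebindX F N (XB13OfRecord θ.toStage3Params lam θ.res.X) :=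
  Stage11Params.toStage5₁₁_rebindX F N θ _

/-- THE PIN IS UP-SIDE: the datum of record is unchanged (g31's `datumOfRecord₁₁_rebindX`). [cite: Balaban1989LargeFieldII, Thm 1 + (0.1) pp.355–356 (bookkeeping)] -/
theorem datumOfRecord₁₁_pinB13 (θ : Stage11Params F N) (h : θ.Provisos₁₁) (lam : B12.RunParams → ResidB13 θ.toStage3Params) :
    datumOfRecord₁₁ F N (θ.pinB13 F N lam) (h.pinB13 lam) = datumOfRecord₁₁ F N θ h :=
  datumOfRecord₁₁_rebindX F N θ h _ (h.pinB13 lam)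

/-! ## §4. The seven-pin Stage-11 view and the cumulative record `IsRecordOfRecord₁₁CB10YZWB8B12B13` -/

/-- **The seven-pin Stage-11 view** ([B13] innermost: the sibling's six-pin view `view₁₁B12B8B10YZW` OF THE [B13]-PINNED parameters, so every earlier face is the earlier modules'
face at `θ.pinB13 lam13` BY NAME). [cite: Balaban1988RG2Cluster, Lemmas 1–3 pp.9–20; Balaban1987RG1, Lemma 4 p.280; Balaban1985RegularSpaces, Thm 2 p.83; Balaban1985UV3, Thm 1 p.257; Balaban1985BackgroundPropagators, Thm 3.1 p.397; Balaban1985Variational, Thm 1 p.279; Balaban1989LargeFieldI, (0.2) p.176 (objects of record)] -/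
def Stage11Params.view₁₁B13B12B8B10YZW (θ : Stage11Params F N) (lam13 : B12.RunParams → ResidB13 θ.toStage3Params) (lam12 : ResidB12 F N θ.τ9.M)
    (lam8 : ResidB8 θ.toStage3Params) (Mstar : ℕ) (ops : OpsY N θ.toStage3Params Mstar) (ζ : ResidZ F N) (lamW : ResidW F N) : Stage5Params F N :=
  (θ.pinB13 F N lam13).view₁₁B12B8B10YZW F N lam12 lam8 Mstar ops ζ lamW

/-- **The `b13` leaf of the S-binding over the seven-pin view IS the leaf at the group of record** (`Iff.rfl`: the [B12] ∕ [B10] ∕ [B8] re-bindings and the Stage-3 substitutions keep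
the [B13] group). [cite: Balaban1988RG2Cluster, Lemma 1 p.9, Lemma 2 p.11, Lemma 3 p.20 (the leaf at the objects of record)] -/
theorem upOfRecord₅CS_view₁₁B13B12B8B10YZW_b13_iff (θ : Stage11Params F N) (lam13 : B12.RunParams → ResidB13 θ.toStage3Params) (lam12 : ResidB12 F N θ.τ9.M)
    (lam8 : ResidB8 θ.toStage3Params) (Mstar : ℕ) (ops : OpsY N θ.toStage3Params Mstar) (ζ : ResidZ F N) (lamW : ResidW F N) (P : B12.RunParams) :
    (upOfRecord₅CS F N (θ.view₁₁B13B12B8B10YZW F N lam13 lam12 lam8 Mstar ops ζ lamW) P).b13 ↔ B13LeafOfRecord θ.toStage3Params (lam13 P) := Iff.rfl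

/-- … the C-binding's too (`Iff.rfl`). [cite: Balaban1988RG2Cluster, Lemmas 1–3 pp.9–20 (bookkeeping)] -/
theorem upOfRecord₅C_view₁₁B13B12B8B10YZW_b13_iff (θ : Stage11Params F N) (lam13 : B12.RunParams → ResidB13 θ.toStage3Params) (lam12 : ResidB12 F N θ.τ9.M)
    (lam8 : ResidB8 θ.toStage3Params) (Mstar : ℕ) (ops : OpsY N θ.toStage3Params Mstar) (ζ : ResidZ F N) (lamW : ResidW F N) (P : B12.RunParams) :
    (upOfRecord₅C F N (θ.view₁₁B13B12B8B10YZW F N lam13 lam12 lam8 Mstar ops ζ lamW) P).b13 ↔ B13LeafOfRecord θ.toStage3Params (lam13 P) := Iff.rfl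

/-- **The leaves of the S-binding over the seven-pin view, by name**: `b13` (`Iff.rfl`) and the six faces of `Record11CarriersB12` at `θ.pinB13 lam13`.
[cite: Balaban1988RG2Cluster, Lemmas 1–3 pp.9–20; Balaban1987RG1, Lemma 4 p.280; Balaban1985RegularSpaces, Lemma 1 – Thm 8 pp.79–101; Balaban1989LargeFieldI, Prop. 1 p.194; Balaban1985BackgroundPropagators, Thm 3.1 p.397; Balaban1985UV3, Thm 1 p.257; Balaban1985Variational, Thm 1 p.279] -/
theorem upOfRecord₅CS_view₁₁B13B12B8B10YZW_leaves (θ : Stage11Params F N) (lam13 : B12.RunParams → ResidB13 θ.toStage3Params) (lam12 : ResidB12 F N θ.τ9.M)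
    (lam8 : ResidB8 θ.toStage3Params) (Mstar : ℕ) (ops : OpsY N θ.toStage3Params Mstar) (ζ : ResidZ F N) (lamW : ResidW F N) (P : B12.RunParams) :
    ((upOfRecord₅CS F N (θ.view₁₁B13B12B8B10YZW F N lam13 lam12 lam8 Mstar ops ζ lamW) P).b13 ↔ B13LeafOfRecord θ.toStage3Params (lam13 P)) ∧
    ((upOfRecord₅CS F N (θ.view₁₁B13B12B8B10YZW F N lam13 lam12 lam8 Mstar ops ζ lamW) P).b12 ↔ B12LeafOfRecord₁₁ F N θ lam12 P) ∧
    ((upOfRecord₅CS F N (θ.view₁₁B13B12B8B10YZW F N lam13 lam12 lam8 Mstar ops ζ lamW) P).b8 ↔ B8LeafOfRecord θ.toStage3Params lam8) ∧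
    ((upOfRecord₅CS F N (θ.view₁₁B13B12B8B10YZW F N lam13 lam12 lam8 Mstar ops ζ lamW) P).rBasicStep ↔ B15Leaf (WOfRecord₁₁ F N θ lamW P)) ∧
    ((upOfRecord₅CS F N (θ.view₁₁B13B12B8B10YZW F N lam13 lam12 lam8 Mstar ops ζ lamW) P).b9 ↔ B9LeafX (Y9OfRecord N θ.toStage3Params Mstar ops)) ∧
    ((upOfRecord₅CS F N (θ.view₁₁B13B12B8B10YZW F N lam13 lam12 lam8 Mstar ops ζ lamW) P).b10 ↔ PrintedUV3V N θ.L) ∧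
    ((upOfRecord₅CS F N (θ.view₁₁B13B12B8B10YZW F N lam13 lam12 lam8 Mstar ops ζ lamW) P).b11 ↔ B11Leaf (Z11OfRecord F N ζ)) :=
  ⟨Iff.rfl, upOfRecord₅CS_view₁₁B12B8B10YZW_leaves F N (θ.pinB13 F N lam13) lam12 lam8 Mstar ops ζ lamW P⟩

/-- **«(D, w) is the record, Stage 11, all SEVEN typed carrier groups [B10] ∕ [B9] ∕ [B11] ∕ [IV] ∕ [B8] ∕ [B12] ∕ [B13] pinned, `b8` surviving»**: the sibling's
`IsRecordOfRecord₁₁CB10YZWB8B12` VERBATIM with a residual [B13] term layer `lam13` (one per run) added and the upstream block the S-binding at the seven-pin view (residual data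
quantified with the record's parameters; no law assumed). [cite: Balaban1988RG2Cluster, Lemmas 1–3 pp.9–20; Balaban1989LargeFieldII, Thm 1 + (0.1) pp.355–356 (objects of record)] -/
def IsRecordOfRecord₁₁CB10YZWB8B12B13 (D : FiniteEpsData F (SU N)) (w : WorldP) : Prop :=
  ∃ (θ : Stage11Params F N) (h : θ.Provisos₁₁) (lam13 : B12.RunParams → ResidB13 θ.toStage3Params) (lam12 : ResidB12 F N θ.τ9.M) (lam8 : ResidB8 θ.toStage3Params)
    (Mstar : ℕ) (ops : OpsY N θ.toStage3Params Mstar) (ζ : ResidZ F N) (lamW : ResidW F N),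
    θ.Admissible ∧ D = datumOfRecord₁₁ F N θ h ∧ w.C = D.C ∧ (0 < w.γ ∧ w.γ ≤ θ.γ) ∧ w.L = (θ.L : ℝ) ∧
      ∀ P : B12.RunParams, w.up P = upOfRecord₅CS F N (θ.view₁₁B13B12B8B10YZW F N lam13 lam12 lam8 Mstar ops ζ lamW) P

/-- Inhabitation is Stage 11's exactly (all seven residual types inhabited; `nonempty_residB13`, `nonempty_residB12`). [cite: Balaban1989LargeFieldII, Thm 1 + (0.1) pp.355–356 (bookkeeping)] -/
theorem exists_world_isRecordOfRecord₁₁CB10YZWB8B12B13 (θ : Stage11Params F N) (h : θ.Provisos₁₁) (hθ : θ.Admissible)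
    (lam13 : B12.RunParams → ResidB13 θ.toStage3Params) (lam12 : ResidB12 F N θ.τ9.M) (lam8 : ResidB8 θ.toStage3Params) (Mstar : ℕ) (ops : OpsY N θ.toStage3Params Mstar)
    (ζ : ResidZ F N) (lamW : ResidW F N) {γw : ℝ} (hγw : 0 < γw ∧ γw ≤ θ.γ) :
    ∃ w : WorldP, IsRecordOfRecord₁₁CB10YZWB8B12B13 F N (datumOfRecord₁₁ F N θ h) w ∧ w.γ = γw := by
  obtain ⟨w₀, -, -⟩ := exists_world_isRecordOfRecord₁₁C F N θ h hθ hγw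
  exact ⟨{ w₀ with
      C := (datumOfRecord₁₁ F N θ h).C, γ := γw, L := (θ.L : ℝ), one_lt_L := by exact_mod_cast θ.hL.2,
      up := fun P => upOfRecord₅CS F N (θ.view₁₁B13B12B8B10YZW F N lam13 lam12 lam8 Mstar ops ζ lamW) P },
    ⟨θ, h, lam13, lam12, lam8, Mstar, ops, ζ, lamW, hθ, rfl, rfl, hγw, rfl, fun _ => rfl⟩, rfl⟩

/-- … in particular the predicate is inhabited over every admissible Stage-11 package (the junk layers of §1 ∕ the sibling modules). [cite: Balaban1989LargeFieldII, Thm 1 + (0.1) pp.355–356 (bookkeeping)] -/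
theorem exists_isRecordOfRecord₁₁CB10YZWB8B12B13 (θ : Stage11Params F N) (h : θ.Provisos₁₁) (hθ : θ.Admissible) (Mstar : ℕ) (ops : OpsY N θ.toStage3Params Mstar)
    {γw : ℝ} (hγw : 0 < γw ∧ γw ≤ θ.γ) : ∃ w : WorldP, IsRecordOfRecord₁₁CB10YZWB8B12B13 F N (datumOfRecord₁₁ F N θ h) w ∧ w.γ = γw := by
  obtain ⟨lam13⟩ := nonempty_residB13 θ.toStage3Params
  obtain ⟨lam12⟩ := nonempty_residB12 F N θ.τ9.M
  obtain ⟨lam8⟩ := nonempty_residB8 (θ := θ.toStage3Params)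
  obtain ⟨ζ⟩ := nonempty_residZ (F := F) (N := N)
  obtain ⟨lamW⟩ := nonempty_residW (F := F) (N := N)
  exact exists_world_isRecordOfRecord₁₁CB10YZWB8B12B13 F N θ h hθ (fun _ => lam13) lam12 lam8 Mstar ops ζ lamW hγw

variable {F N}
variable {D : FiniteEpsData F (SU N)} {w : WorldP}

/-- **Refinement `IsRecordOfRecord₁₁CB10YZWB8B12B13 → IsRecordOfRecord₁₁CB10YZWB8B12` with THE SAME datum AND THE SAME world** (witness `θ.pinB13 lam13`: provisos transported,
admissibility by the `iff`, datum by `datumOfRecord₁₁_pinB13`, the view definitionally); hence, by the sibling modules' refinements, also `→ …B8` and the `₁₁CB10YZW` ∕ `₁₁C` companions.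
[cite: Balaban1989LargeFieldII, Thm 1 + (0.1) pp.355–356 (bookkeeping)] -/
theorem isRecordOfRecord₁₁CB10YZWB8B12_of_isRecordOfRecord₁₁CB10YZWB8B12B13 (h : IsRecordOfRecord₁₁CB10YZWB8B12B13 F N D w) :
    IsRecordOfRecord₁₁CB10YZWB8B12 F N D w := by
  obtain ⟨θ, hP, lam13, lam12, lam8, Mstar, ops, ζ, lamW, hθ, hD, hC, hγ, hL, hup⟩ := h
  refine ⟨θ.pinB13 F N lam13, hP.pinB13 lam13, lam12, lam8, Mstar, ops, ζ, lamW, (Stage11Params.pinB13_admissible_iff F N _ _).2 hθ, ?_, hC, hγ, hL, hup⟩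
  rw [datumOfRecord₁₁_pinB13]
  exact hD

/-- … and `→ IsRecordOfRecord₁₁CB10YZWB8` (the two refinements composed). [cite: Balaban1989LargeFieldII, Thm 1 + (0.1) pp.355–356 (bookkeeping)] -/
theorem isRecordOfRecord₁₁CB10YZWB8_of_isRecordOfRecord₁₁CB10YZWB8B12B13 (h : IsRecordOfRecord₁₁CB10YZWB8B12B13 F N D w) : IsRecordOfRecord₁₁CB10YZWB8 F N D w :=
  isRecordOfRecord₁₁CB10YZWB8_of_isRecordOfRecord₁₁CB10YZWB8B12 (isRecordOfRecord₁₁CB10YZWB8B12_of_isRecordOfRecord₁₁CB10YZWB8B12B13 h)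

/-- The construction-side in-edges `b4`–`b7` at a record of this module (`Record11CarriersB8`'s, through the refinements). [cite: Balaban1989LargeFieldII, Thm 1 p.355 (bookkeeping)] -/
theorem b4_b5_b6_b7_of_isRecordOfRecord₁₁CB10YZWB8B12B13 (h : IsRecordOfRecord₁₁CB10YZWB8B12B13 F N D w) (P : B12.RunParams) :
    (leavesP w P).b4 ∧ (leavesP w P).b5 ∧ (leavesP w P).b6 ∧ (leavesP w P).b7 :=
  b4_b5_b6_b7_of_isRecordOfRecord₁₁CB10YZWB8 (isRecordOfRecord₁₁CB10YZWB8_of_isRecordOfRecord₁₁CB10YZWB8B12B13 h) P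

/-- RE-BINDING a `₁₁C` record's world by the S-binding at the seven-pin view gives a record of this module with the SAME datum. [cite: Balaban1989LargeFieldII, Thm 1 p.355 (bookkeeping)] -/
theorem isRecordOfRecord₁₁CB10YZWB8B12B13_rebind_of_isRecordOfRecord₁₁C (h : IsRecordOfRecord₁₁C F N D w) :
    ∃ (θ : Stage11Params F N) (_ : θ.Provisos₁₁), θ.Admissible ∧ (∀ P, w.up P = upOfRecord₅C F N (θ.toStage5₁₁ F N) P) ∧
      ∀ (lam13 : B12.RunParams → ResidB13 θ.toStage3Params) (lam12 : ResidB12 F N θ.τ9.M) (lam8 : ResidB8 θ.toStage3Params) (Mstar : ℕ)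
        (ops : OpsY N θ.toStage3Params Mstar) (ζ : ResidZ F N) (lamW : ResidW F N),
        IsRecordOfRecord₁₁CB10YZWB8B12B13 F N D { w with up := fun P => upOfRecord₅CS F N (θ.view₁₁B13B12B8B10YZW F N lam13 lam12 lam8 Mstar ops ζ lamW) P } := by
  obtain ⟨θ, hP, hθ, hD, hC, hγ, hL, hup⟩ := h
  exact ⟨θ, hP, hθ, hup, fun lam13 lam12 lam8 Mstar ops ζ lamW => ⟨θ, hP, lam13, lam12, lam8, Mstar, ops, ζ, lamW, hθ, hD, hC, hγ, hL, fun _ => rfl⟩⟩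

/-- **THE SEVEN PINNED LEAVES AT A RECORD OF THIS MODULE, for ONE parameter package**. [cite: Balaban1988RG2Cluster, Lemmas 1–3 pp.9–20; Balaban1987RG1, Lemma 4 p.280; Balaban1985RegularSpaces, Lemma 1 – Thm 8 pp.79–101; Balaban1989LargeFieldI, Prop. 1 p.194; Balaban1985BackgroundPropagators, Thm 3.1 p.397; Balaban1985UV3, Thm 1 p.257; Balaban1985Variational, Thm 1 p.279] -/
theorem leaves_iff_of_isRecordOfRecord₁₁CB10YZWB8B12B13 (h : IsRecordOfRecord₁₁CB10YZWB8B12B13 F N D w) :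
    ∃ (θ : Stage11Params F N) (lam13 : B12.RunParams → ResidB13 θ.toStage3Params) (lam12 : ResidB12 F N θ.τ9.M) (lam8 : ResidB8 θ.toStage3Params) (Mstar : ℕ)
      (ops : OpsY N θ.toStage3Params Mstar) (ζ : ResidZ F N) (lamW : ResidW F N), θ.Admissible ∧ w.L = (θ.L : ℝ) ∧ ∀ P : B12.RunParams,
        ((leavesP w P).b13 ↔ B13LeafOfRecord θ.toStage3Params (lam13 P)) ∧ ((leavesP w P).b12 ↔ B12LeafOfRecord₁₁ F N θ lam12 P) ∧
        ((leavesP w P).b8 ↔ B8LeafOfRecord θ.toStage3Params lam8) ∧ ((leavesP w P).rBasicStep ↔ B15Leaf (WOfRecord₁₁ F N θ lamW P)) ∧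
        ((leavesP w P).b9 ↔ B9LeafX (Y9OfRecord N θ.toStage3Params Mstar ops)) ∧ ((leavesP w P).b10 ↔ PrintedUV3V N θ.L) ∧
        ((leavesP w P).b11 ↔ B11Leaf (Z11OfRecord F N ζ)) := by
  obtain ⟨θ, -, lam13, lam12, lam8, Mstar, ops, ζ, lamW, hθ, -, -, -, hL, hup⟩ := h
  refine ⟨θ, lam13, lam12, lam8, Mstar, ops, ζ, lamW, hθ, hL, fun P => ?_⟩
  have hl := upOfRecord₅CS_view₁₁B13B12B8B10YZW_leaves F N θ lam13 lam12 lam8 Mstar ops ζ lamW P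
  refine ⟨?_, ?_, ?_, ?_, ?_, ?_, ?_⟩
  · show (w.up P).b13 ↔ _
    rw [hup P]; exact hl.1
  · show (w.up P).b12 ↔ _
    rw [hup P]; exact hl.2.1
  · show (w.up P).b8 ↔ _
    rw [hup P]; exact hl.2.2.1
  · show (w.up P).rBasicStep ↔ _
    rw [hup P]; exact hl.2.2.2.1
  · show (w.up P).b9 ↔ _
    rw [hup P]; exact hl.2.2.2.2.1
  · show (w.up P).b10 ↔ _
    rw [hup P]; exact hl.2.2.2.2.2.1
  · show (w.up P).b11 ↔ _
    rw [hup P]; exact hl.2.2.2.2.2.2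

/-- **THE OWN LEAF OF N10 AT A RECORD OF THIS MODULE**: `b13` IS the printed triple at the group of record, for one parameter package. [cite: Balaban1988RG2Cluster, Lemma 1 p.9, Lemma 2 p.11, Lemma 3 p.20 (the leaf at the objects of record)] -/
theorem leaf_b13_iff_of_isRecordOfRecord₁₁CB10YZWB8B12B13 (h : IsRecordOfRecord₁₁CB10YZWB8B12B13 F N D w) :
    ∃ (θ : Stage11Params F N) (lam13 : B12.RunParams → ResidB13 θ.toStage3Params), θ.Admissible ∧ w.L = (θ.L : ℝ) ∧
      ∀ P : B12.RunParams, (leavesP w P).b13 ↔ B13LeafOfRecord θ.toStage3Params (lam13 P) := by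
  obtain ⟨θ, lam13, _, _, _, _, _, _, hθ, hL, hl⟩ := leaves_iff_of_isRecordOfRecord₁₁CB10YZWB8B12B13 h
  exact ⟨θ, lam13, hθ, hL, fun P => (hl P).1⟩

/-- **N10 AT A RECORD OF THIS MODULE**: «b9 → b10 → b11 → b12 → b13» with `b13` THE LEAF AT THE GROUP OF RECORD (the in-edges as the world's leaves; their pinned readings are
`leaves_iff_of_…` ∕ the next theorem). [cite: Balaban1988RG2Cluster, Lemmas 1–3 pp.9, 11, 20 (the node at the objects of record)] -/
theorem b13_main_iff_of_isRecordOfRecord₁₁CB10YZWB8B12B13 (h : IsRecordOfRecord₁₁CB10YZWB8B12B13 F N D w) :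
    ∃ (θ : Stage11Params F N) (lam13 : B12.RunParams → ResidB13 θ.toStage3Params), θ.Admissible ∧ w.L = (θ.L : ℝ) ∧ ∀ P : B12.RunParams,
      (Dag.B13_main (leavesP w P) ↔
        ((leavesP w P).b9 → (leavesP w P).b10 → (leavesP w P).b11 → (leavesP w P).b12 → B13LeafOfRecord θ.toStage3Params (lam13 P))) := by
  obtain ⟨θ, lam13, hθ, hL, hl⟩ := leaf_b13_iff_of_isRecordOfRecord₁₁CB10YZWB8B12B13 h
  refine ⟨θ, lam13, hθ, hL, fun P => ?_⟩
  have h13 := hl P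
  exact ⟨fun hN h9 h10 h11 h12 => h13.1 (hN h9 h10 h11 h12), fun hN h9 h10 h11 h12 => h13.2 (hN h9 h10 h11 h12)⟩

/-- **N10 AT THE BUNDLES OF RECORD, for ONE parameter package** (every in-edge in its pinned reading).
[cite: Balaban1988RG2Cluster, Lemmas 1–3 pp.9, 11, 20; Balaban1985BackgroundPropagators, Thm 3.1 p.397; Balaban1985UV3, Thm 1 p.257; Balaban1985Variational, Thm 1 p.279; Balaban1987RG1, Lemma 4 p.280 (the node at the objects of record)] -/
theorem b13_main_iff_bundles_of_isRecordOfRecord₁₁CB10YZWB8B12B13 (h : IsRecordOfRecord₁₁CB10YZWB8B12B13 F N D w) :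
    ∃ (θ : Stage11Params F N) (lam13 : B12.RunParams → ResidB13 θ.toStage3Params) (lam12 : ResidB12 F N θ.τ9.M) (Mstar : ℕ) (ops : OpsY N θ.toStage3Params Mstar)
      (ζ : ResidZ F N), θ.Admissible ∧ w.L = (θ.L : ℝ) ∧ ∀ P : B12.RunParams,
        (Dag.B13_main (leavesP w P) ↔
          (B9LeafX (Y9OfRecord N θ.toStage3Params Mstar ops) → PrintedUV3V N θ.L → B11Leaf (Z11OfRecord F N ζ) → B12LeafOfRecord₁₁ F N θ lam12 P →
            B13LeafOfRecord θ.toStage3Params (lam13 P))) := by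
  obtain ⟨θ, lam13, lam12, lam8, Mstar, ops, ζ, lamW, hθ, hL, hl⟩ := leaves_iff_of_isRecordOfRecord₁₁CB10YZWB8B12B13 h
  refine ⟨θ, lam13, lam12, Mstar, ops, ζ, hθ, hL, fun P => ?_⟩
  obtain ⟨h13, h12, -, -, h9, h10, h11⟩ := hl P
  rw [B13NodeKnitRecord5C.b13_main_iff_up]
  show ((leavesP w P).b9 → (leavesP w P).b10 → (leavesP w P).b11 → (leavesP w P).b12 → (leavesP w P).b13) ↔ _
  rw [h9, h10, h11, h12, h13]

/-- **N10 «SLOTS» FORM at a record of this module** (a closer supplies the leaf at the group of record from the in-edges at every presenting parameter package, over the HIDDEN residual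
layers — honest; e.g. `b13_main_at_rebindX_XB13OfRecord` ∕ `B13NodeTorusTermwise.b13Leaf_twoTorus_termwise` at `WtOfRecord`). [cite: Balaban1988RG2Cluster, Lemmas 1–3 pp.9, 11, 20 (the node's shape, bookkeeping)] -/
theorem b13_main_of_isRecordOfRecord₁₁CB10YZWB8B12B13_of_slots (h : IsRecordOfRecord₁₁CB10YZWB8B12B13 F N D w)
    (hB : ∀ (θ : Stage11Params F N) (hP : θ.Provisos₁₁) (lam13 : B12.RunParams → ResidB13 θ.toStage3Params) (lam12 : ResidB12 F N θ.τ9.M) (lam8 : ResidB8 θ.toStage3Params)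
      (Mstar : ℕ) (ops : OpsY N θ.toStage3Params Mstar) (ζ : ResidZ F N) (lamW : ResidW F N), θ.Admissible → D = datumOfRecord₁₁ F N θ hP →
        (∀ P, w.up P = upOfRecord₅CS F N (θ.view₁₁B13B12B8B10YZW F N lam13 lam12 lam8 Mstar ops ζ lamW) P) →
          ∀ P, B9LeafX (Y9OfRecord N θ.toStage3Params Mstar ops) → PrintedUV3V N θ.L → B11Leaf (Z11OfRecord F N ζ) → B12LeafOfRecord₁₁ F N θ lam12 P →
            B13LeafOfRecord θ.toStage3Params (lam13 P))
    (P : B12.RunParams) : Dag.B13_main (leavesP w P) := by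
  obtain ⟨θ, hP, lam13, lam12, lam8, Mstar, ops, ζ, lamW, hθ, hD, -, -, -, hup⟩ := h
  have hl := upOfRecord₅CS_view₁₁B13B12B8B10YZW_leaves F N θ lam13 lam12 lam8 Mstar ops ζ lamW P
  rw [B13NodeKnitRecord5C.b13_main_iff_up, hup P]
  intro h9 h10 h11 h12
  exact hl.1.2 (hB θ hP lam13 lam12 lam8 Mstar ops ζ lamW hθ hD hup P (hl.2.2.2.2.1.1 h9) (hl.2.2.2.2.2.1.1 h10) (hl.2.2.2.2.2.2.1 h11) (hl.2.1.1 h12))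

end Pin11

end Literature.MathematicalPhysics.QuantumFieldTheory.Balaban1983to89.Node00
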